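import Summits.QuantumFields.YangMills.Theorems.UnitScaleTiltProp7Eq128AtMemberOfCrit127TwoSlotT3
import Summits.QuantumFields.YangMills.Theorems.UnitScaleTiltProp7Crit127OfCrit93Split
import Summits.QuantumFields.YangMills.Theorems.UnitScaleTiltProp7ChartRealityKnitS
import Summits.QuantumFields.YangMills.Theorems.UnitScaleTiltProp7SectET3JcurReality
import HarnessLib

/-!
# Route `UnitScaleTilt`, crux «MinimiserStabilityRegPr» (stmt-QuantumFields-19200, stub EX `stub_existenceMinimalOrbit`), route (α) — «H128-FAMILY», MEMBER HALF:
# **PRINT's (128) FOR A CHART VALUE FROM (93) ON THE SLICE + THE (124)–(126) SPLIT + THE LATTICE (84) ROW** — the composition, at ONE member and with FREE letters, of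
# ★px21's ✓`Prop7Crit127OfCrit93Split.hCrit127_of_hCrit93_of_split127` ((93) + split ⟹ (127)), ★px21's ✓`Prop7Eq128AtMemberOfCrit127TwoSlot.inner_toL2_residual_eq_zero_of_hCrit127_of_hasDerivAt_actionZ_field`
# ((127) + (84) ⟹ (128) in pairing form) and ✓`Prop7HermDensity.exists_eq_adjoint_Qk_of_hermitian_traceless` (pairing form ⟹ range-`Q_k†` form), with the reality of the chart ray ((51),
# ✓`Prop7ChartRealityKnitS.isHermitian_trace_zero_of_chartS`), the `QTwS` sector rows (✓`Prop7QTwSRealityOfRegPr`) and the tracelessness of the residual (slot row `hOptr` + ✓`Prop7SectET3JcurReality`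
# + the reality of `Ŵ(A′)`) DISCHARGED — so that the family door (`…H128OfCrit127Family`, the EX namer ★w2-19200 g7's word «px16: H128-FAMILY» 2026-08-28T23:34:35Z) reads only the display's
# `hCrit93′`, a split row, the (84) row, the chart-conjugacy row and letter rows.

Cell `ym3-torus` (HUMAN RULING D-0037, YM ladder rung R3 — YM₃ on T³, NOT d = 4, NOT Clay; YM gap NOT proved), width seat `ym3-torus-px16` (gen 3).  THEOREMS ONLY (0 `def`, 0 `sorry`);
`--supports stmt-QuantumFields-19200 --as helper`, count-neutral.  Nothing here claims the stub, the crux, d = 4 or the mass gap.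

THE PRINT.  [Balaban1985Variational] p.297: (127) «⟨δA′, J⟩ + ⟨δA′, (Δ − Δ⁽²⁾)A′₁⟩ + ⟨δA′, ((δ∕δA′)V)(A′₁)⟩ = 0 for all δA′ satisfying QδA′ = 0», derived there from (93) (criticality on the Landau slice
(82)–(83)) and the `f`-fibration (123)–(126); (128) «⟨δA′, J⟩ + ⟨δA′, Δ_aA′₁⟩ − … = 0», i.e. the residual lies in `(ker Q)^⊥ = range Q*`; (84) p.290; (51) p.286.

WHAT IS PROVED (ns `…Theorems.Prop7H128OfCrit93Split127Member`; member `(F, n ≤ K)`, background `U₀ ∈ 𝔘_k(ε₀)` in the windows `10⁹L²e ≤ 1`, `10¹²L³ε₀ ≤ 1`; the (46) letter `H` with `hb hHop hHR`;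
the chart `χ(Y) = Y − H·Dfix(CmapTwS U₀) H C₂ˢ Y`, `C₂ˢ = 40·6(2e + 2700Lε₀)∕(eη)²`, windows `9C₂ˢbε < 1`, `6ε ≤ eη`; a FREE (115)-field `A′` with `κ_f•ιA′` in the half ball and `ιA′` Hermitian
traceless; FREE letters `W` (print's `(δ∕δA′)V`), `Tc` (the (115)-level chart), and a FREE operator slot `Δx U₀`).
★★★ `exists_eq_adjoint_Qk_of_hCrit93_split127` — from `hCrit93` ((93), ray form, on the slice `QTwS δ = 0 ∧ IsLandauPrintS δ`), `hSplit127` (the (124)–(126) split in ✓p650826's shape),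
`hZ` (lit (84) along `Tc(A′ + tδ′)`), `hchart` (chart conjugacy near `t = 0`), the slot's traceless row `hOptr` and the reality row `hWR` of `Ŵ(A′)`:
`∃ μ, Δx U₀ (toL2 ιA′) + funEquiv⁻¹(NegSup.equiv Ĵ + NegSup.equiv Ŵ(A′)) = Q_k† μ`.
HONEST SCOPE: composition by name + the (51)∕sector∕trace bookkeeping; (93), the split, (84) and the chart conjugacy are HYPOTHESES with the suppliers of record (display row `hCrit93′`; the (P2)
transport lineage + ✓`Crit127Split127AtZero.split127_at_zero`; ★px21 «HZ-84-ETA-MEMBER»; ✓`Prop7ChartConjPInv`); nothing of print is asserted; not a proof of the stub.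

References: T. Bałaban, CMP **102** (1985) 277–309 [Balaban1985Variational] ((123)–(128) p.296–297, (93) p.291, (82)–(84) p.290, (47)–(51) pp.285–286); CMP **99** (1985) 389–434
[Balaban1985BackgroundPropagators] ((3.1) p.390, (3.6)–(3.7) p.391, (3.13)–(3.15) p.393, (3.26) p.395); CMP **99** (1985) 75–102 [Balaban1985RegularSpaces] (Sect. D pp.89–95).
-/

set_option autoImplicit false

noncomputable section

open scoped InnerProductSpace ComplexConjugate Matrix.Norms.L2Operator BigOperators Topology

namespace Summit.QuantumFields.YangMills.Theorems.Prop7H128OfCrit93Split127Member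

open NormedSpace
open Literature.Analysis.Calculus.ExpDifferential (ad gSer)
open Literature.MathematicalPhysics.QuantumFieldTheory.Balaban1983to89
open Literature.MathematicalPhysics.QuantumFieldTheory.Balaban1983to89.T3ContinuumYM3Torus
open Literature.MathematicalPhysics.QuantumFieldTheory.Balaban1983to89.T3PrintedRegularMinimiser (RegPr)
open Literature.MathematicalPhysics.QuantumFieldTheory.Balaban1983to89.T3SectALandauChart (eta eta_pos emb15 bgUnits)
open B9SectCLatticeCarrier (Bond)
open B9Eq311L2Pairing (WL2)
open B11Eq115Space (NegSize Space115 JetSup NegSup levWeight)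
open B11Eq111FrakG (nabla115)
open B11Eq103H1Complex (SiteL2K BondL2K funEquiv funEquiv_symm_apply)
open B11Eq98CurrentSlot (Jcur)
open B11Eq90Transpose (pair27)
open B11Eq90V0primeCurrent (Tsh Ucur curL flat115)
open B9Eq3119DeltaPiCarrier (currentCLM)
open B9Eq39Adjoint (prodCfg)
open B9Eq31ActionZpow (actionZ)
open B11Prop3Model (Dfix)
open Summit.QuantumFields.YangMills.Theorems.Prop7TPrint (expHermField)
open Summit.QuantumFields.YangMills.Theorems.Prop7SPrint (IsLandauPrintS)
open Summit.QuantumFields.YangMills.Theorems.Prop7SectET3Transport (periodsT3 bondEquiv bgOfCfg)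
open Summit.QuantumFields.YangMills.Theorems.Prop7SectET3HilbertLetters (W₂ frobEquiv toL2 toL2_symm_apply)
open Summit.QuantumFields.YangMills.Theorems.Prop7SectET3CurvedPropagators (Qk)
open Summit.QuantumFields.YangMills.Theorems.Prop7SymAvgTwSym (QTwS CmapTwS QTwS_star_comm_of_regPr QTwS_scalar_of_regPr QTwS_traceless_of_regPr)
open Summit.QuantumFields.YangMills.Theorems.Prop7HermDensity (exists_eq_adjoint_Qk_of_hermitian_traceless)
open Summit.QuantumFields.YangMills.Theorems.Prop7Eq128AtMemberOfCrit127TwoSlot (inner_toL2_residual_eq_zero_of_hCrit127_of_hasDerivAt_actionZ_field)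
open Summit.QuantumFields.YangMills.Theorems.Prop7Crit127OfCrit93Split (hCrit127_of_hCrit93_of_split127)
open Summit.QuantumFields.YangMills.Theorems.Prop7ChartRealityKnitS (isHermitian_trace_zero_of_chartS)
open Summit.QuantumFields.YangMills.Theorems.Prop7FibreELOfCritSplit (skew_add_real_smul)
open Summit.QuantumFields.YangMills.Theorems.Prop7SectET3JcurReality (isHermitian_trace_zero_Jcur_bgOfCfg)

variable {F : T3Family} {n K : ℕ} {h : n ≤ K} {c₀ cB : ℝ} [Fact (0 < c₀)] [Fact (0 < cB)]
  {Δx : GaugeField (F.P K) 0 (Matrix.specialUnitaryGroup (Fin 2) ℂ) → (BondL2K ℂ 3 (periodsT3 F K) c₀ W₂ →ₗ[ℂ] BondL2K ℂ 3 (periodsT3 F K) c₀ W₂)}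
  [Fact (0 < (F.L : ℝ))] [Fact (0 < ((F.L : ℝ)⁻¹) ^ (K - n))]

/-- ★★★ **PRINT's (128) FOR A CHART VALUE, RANGE-`Q_k†` FORM, FROM (93) + THE (124)–(126) SPLIT + THE (84) ROW** (member; free field `A′`, free letters `W Tc H`, free slot `Δx U₀`).
[cite: Balaban1985Variational, (123)–(128) pp.296–297, (93) p.291, (82)–(84) p.290, (47)–(51) pp.285–286; Balaban1985BackgroundPropagators, (3.1) p.390, (3.6)–(3.7) p.391, (3.13)–(3.15) p.393, (3.26) p.395; Balaban1985RegularSpaces, Sect. D pp.89–95] -/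
theorem exists_eq_adjoint_Qk_of_hCrit93_split127 {ε₀ e b ε : ℝ} (hε₀ : 0 < ε₀) (he : 0 < e) (hWe : 10 ^ 9 * (F.L : ℝ) ^ 2 * e ≤ 1) (hWε : 10 ^ 12 * (F.L : ℝ) ^ 3 * ε₀ ≤ 1)
    (U₀ : GaugeField (F.P K) 0 (Matrix.specialUnitaryGroup (Fin 2) ℂ)) (hreg : RegPr F n K ε₀ U₀)
    -- the (46) letter `H` with its bound and reality (the display's `Hf`, `h46₀`, `hHfR`)
    {H : (PBond (F.P n) 0 → Matrix (Fin 2) (Fin 2) ℂ) →ₗ[ℂ] (PBond (F.P K) 0 → Matrix (Fin 2) (Fin 2) ℂ)} (hb : 0 ≤ b) (hHop : ∀ Y, ‖H Y‖ ≤ b * ‖Y‖)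
    (hHR : ∀ Y : PBond (F.P n) 0 → Matrix (Fin 2) (Fin 2) ℂ, (∀ c, star (Y c) = -Y c ∧ (Y c).trace = 0) → ∀ b', star (H Y b') = -H Y b' ∧ (H Y b').trace = 0)
    -- the chart windows of (D47)∕(51)
    (hq : 9 * (40 * (2 * (3 * (2 * e + 2700 * (F.L : ℝ) * ε₀))) / (e * eta F n K) ^ 2) * b * ε < 1) (hRε : 6 * ε ≤ e * eta F n K)
    -- the chart value's coordinate: a FREE (115)-field `A′`, REAL, with `κ_f • ιA′` in the HALF ball
    (A' : Space115 (F.L : ℝ) (((F.L : ℝ)⁻¹) ^ (K - n)) (fun _ : Bond 3 (periodsT3 F K) => K - n) (fun _ : Bond 3 (periodsT3 F K) × Fin 3 => K - n)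
      (nabla115 (((F.L : ℝ)⁻¹) ^ (K - n)) (bgOfCfg F K U₀)))
    (hA'R : ∀ b' : PBond (F.P K) 0, (JetSup.equiv _ _ _ A' (bondEquiv F K b')).IsHermitian ∧ (JetSup.equiv _ _ _ A' (bondEquiv F K b')).trace = 0)
    (hA'ε : 2 * ‖((((eta F n K : ℝ) : ℂ)) * Complex.I) • (fun b' : PBond (F.P K) 0 => JetSup.equiv _ _ _ A' (bondEquiv F K b'))‖ < ε)
    -- the letters `W = (δ∕δA′)V` (opaque) with the reality of its value at `A′`, and the (115)-level chart `Tc` (opaque)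
    (W : Space115 (F.L : ℝ) (((F.L : ℝ)⁻¹) ^ (K - n)) (fun _ : Bond 3 (periodsT3 F K) => K - n) (fun _ : Bond 3 (periodsT3 F K) × Fin 3 => K - n)
        (nabla115 (((F.L : ℝ)⁻¹) ^ (K - n)) (bgOfCfg F K U₀)) →
      NegSize (F.L : ℝ) (((F.L : ℝ)⁻¹) ^ (K - n)) (fun _ : Bond 3 (periodsT3 F K) => K - n) 3 (Matrix (Fin 2) (Fin 2) ℂ))
    (hWR : ∀ p : Bond 3 (periodsT3 F K), (NegSup.equiv _ _ (W A') p).IsHermitian ∧ (NegSup.equiv _ _ (W A') p).trace = 0)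
    (Tc : Space115 (F.L : ℝ) (((F.L : ℝ)⁻¹) ^ (K - n)) (fun _ : Bond 3 (periodsT3 F K) => K - n) (fun _ : Bond 3 (periodsT3 F K) × Fin 3 => K - n)
        (nabla115 (((F.L : ℝ)⁻¹) ^ (K - n)) (bgOfCfg F K U₀)) →
      Space115 (F.L : ℝ) (((F.L : ℝ)⁻¹) ^ (K - n)) (fun _ : Bond 3 (periodsT3 F K) => K - n) (fun _ : Bond 3 (periodsT3 F K) × Fin 3 => K - n)
        (nabla115 (((F.L : ℝ)⁻¹) ^ (K - n)) (bgOfCfg F K U₀)))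
    -- the operator slot's traceless row (at `Δx := Δ^η + T_Jᴾ`: ✓`trace_DeltaEta_toL2_eq_zero` + ✓`TJP_rows_at_regPr`)
    (hOptr : ∀ A : PBond (F.P K) 0 → Matrix (Fin 2) (Fin 2) ℂ, (∀ b', (A b').trace = 0) → ∀ b', ((toL2 F K c₀).symm (Δx U₀ (toL2 F K c₀ A)) b').trace = 0)
    -- ROW (93): ray criticality of the chart action at `κ_f • ιA′` along the SLICE directions ([Balaban1985Variational] Sect. C)
    (hCrit93 : ∀ δ : PBond (F.P K) 0 → Matrix (Fin 2) (Fin 2) ℂ, (∀ b', star (δ b') = -δ b' ∧ (δ b').trace = 0) → QTwS F n K h U₀ δ = 0 →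
      IsLandauPrintS F n K h c₀ cB U₀ δ →
      deriv (fun t : ℝ => wilsonAction4 (emb15 U₀ (expHermField (fun b' : PBond (F.P K) 0 => (-Complex.I) •
        ((((((eta F n K : ℝ) : ℂ)) * Complex.I) • (fun b' : PBond (F.P K) 0 => JetSup.equiv _ _ _ A' (bondEquiv F K b')) + (t : ℂ) • δ)
          - H (Dfix (CmapTwS F n K h U₀) H (40 * (2 * (3 * (2 * e + 2700 * (F.L : ℝ) * ε₀))) / (e * eta F n K) ^ 2)
              ((((( eta F n K : ℝ) : ℂ)) * Complex.I) • (fun b' : PBond (F.P K) 0 => JetSup.equiv _ _ _ A' (bondEquiv F K b')) + (t : ℂ) • δ))) b')))) 0 = 0)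
    -- ROW (124)–(126): the `f`-fibration of `ker Q`, linearised at the chart point (✓p650826's `hSplit127` shape)
    (hSplit127 : ∀ D : (PBond (F.P K) 0 → Matrix (Fin 2) (Fin 2) ℂ) →L[ℂ] (PBond (F.P K) 0 → Matrix (Fin 2) (Fin 2) ℂ),
      HasFDerivAt (fun A : PBond (F.P K) 0 → Matrix (Fin 2) (Fin 2) ℂ =>
        A - H (Dfix (CmapTwS F n K h U₀) H (40 * (2 * (3 * (2 * e + 2700 * (F.L : ℝ) * ε₀))) / (e * eta F n K) ^ 2) A)) D
        (((((eta F n K : ℝ) : ℂ)) * Complex.I) • (fun b' : PBond (F.P K) 0 => JetSup.equiv _ _ _ A' (bondEquiv F K b'))) →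
      ∀ δ : PBond (F.P K) 0 → Matrix (Fin 2) (Fin 2) ℂ, (∀ b', star (δ b') = -δ b' ∧ (δ b').trace = 0) → QTwS F n K h U₀ δ = 0 →
      ∃ δL : PBond (F.P K) 0 → Matrix (Fin 2) (Fin 2) ℂ, (∀ b', star (δL b') = -δL b' ∧ (δL b').trace = 0) ∧ QTwS F n K h U₀ δL = 0 ∧ IsLandauPrintS F n K h c₀ cB U₀ δL ∧
        ∃ N : Site (F.P K) 0 → Matrix (Fin 2) (Fin 2) ℂ, (∀ x, (N x).IsHermitian ∧ (N x).trace = 0) ∧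
          ∀ b' : PBond (F.P K) 0,
            gSer ℂ (ad ℂ (-((((((eta F n K : ℝ) : ℂ)) * Complex.I) • (fun b' : PBond (F.P K) 0 => JetSup.equiv _ _ _ A' (bondEquiv F K b')))
                - H (Dfix (CmapTwS F n K h U₀) H (40 * (2 * (3 * (2 * e + 2700 * (F.L : ℝ) * ε₀))) / (e * eta F n K) ^ 2)
                    (((((eta F n K : ℝ) : ℂ)) * Complex.I) • (fun b' : PBond (F.P K) 0 => JetSup.equiv _ _ _ A' (bondEquiv F K b'))))) b')) ((D δ) b')
              = gSer ℂ (ad ℂ (-((((((eta F n K : ℝ) : ℂ)) * Complex.I) • (fun b' : PBond (F.P K) 0 => JetSup.equiv _ _ _ A' (bondEquiv F K b')))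
                - H (Dfix (CmapTwS F n K h U₀) H (40 * (2 * (3 * (2 * e + 2700 * (F.L : ℝ) * ε₀))) / (e * eta F n K) ^ 2)
                    (((((eta F n K : ℝ) : ℂ)) * Complex.I) • (fun b' : PBond (F.P K) 0 => JetSup.equiv _ _ _ A' (bondEquiv F K b'))))) b')) ((D δL) b')
                + (Complex.I • N b'.src
                    - ((emb15 U₀ (expHermField (fun b' : PBond (F.P K) 0 => (-Complex.I) •
                        ((((((eta F n K : ℝ) : ℂ)) * Complex.I) • (fun b' : PBond (F.P K) 0 => JetSup.equiv _ _ _ A' (bondEquiv F K b')))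
                          - H (Dfix (CmapTwS F n K h U₀) H (40 * (2 * (3 * (2 * e + 2700 * (F.L : ℝ) * ε₀))) / (e * eta F n K) ^ 2)
                              (((((eta F n K : ℝ) : ℂ)) * Complex.I) • (fun b' : PBond (F.P K) 0 => JetSup.equiv _ _ _ A' (bondEquiv F K b'))))) b')) b' :
                        Matrix.specialUnitaryGroup (Fin 2) ℂ) : Matrix (Fin 2) (Fin 2) ℂ) * (Complex.I • N b'.tgt)
                    * star ((emb15 U₀ (expHermField (fun b' : PBond (F.P K) 0 => (-Complex.I) •
                        ((((((eta F n K : ℝ) : ℂ)) * Complex.I) • (fun b' : PBond (F.P K) 0 => JetSup.equiv _ _ _ A' (bondEquiv F K b')))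
                          - H (Dfix (CmapTwS F n K h U₀) H (40 * (2 * (3 * (2 * e + 2700 * (F.L : ℝ) * ε₀))) / (e * eta F n K) ^ 2)
                              (((((eta F n K : ℝ) : ℂ)) * Complex.I) • (fun b' : PBond (F.P K) 0 => JetSup.equiv _ _ _ A' (bondEquiv F K b'))))) b')) b' :
                        Matrix.specialUnitaryGroup (Fin 2) ℂ) : Matrix (Fin 2) (Fin 2) ℂ)))
    -- ROW (84): lit's derivative of `actionZ` along the chart ray `Tc(A′ + tδ′)` ([Balaban1985Variational] (84) p.290; ★px21 «HZ-84-ETA-MEMBER» at `Δx := Δ^η + T_Jᴾ`)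
    (hZ : ∀ δ' : Space115 (F.L : ℝ) (((F.L : ℝ)⁻¹) ^ (K - n)) (fun _ : Bond 3 (periodsT3 F K) => K - n) (fun _ : Bond 3 (periodsT3 F K) × Fin 3 => K - n)
        (nabla115 (((F.L : ℝ)⁻¹) ^ (K - n)) (bgOfCfg F K U₀)),
      (∀ b' : PBond (F.P K) 0, star (JetSup.equiv _ _ _ δ' (bondEquiv F K b')) = JetSup.equiv _ _ _ δ' (bondEquiv F K b')) →
      (∀ b' : PBond (F.P K) 0, Matrix.trace (JetSup.equiv _ _ _ δ' (bondEquiv F K b')) = 0) →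
      QTwS F n K h U₀ (fun b' : PBond (F.P K) 0 => JetSup.equiv _ _ _ δ' (bondEquiv F K b')) = 0 →
      HasDerivAt (fun t : ℝ => actionZ Tsh (((F.L : ℝ)⁻¹) ^ (K - n)) 3
        ((LinearMap.toContinuousLinearMap (Matrix.traceLinearMap (Fin 2) ℂ ℂ) : Matrix (Fin 2) (Fin 2) ℂ →L[ℂ] ℂ) : Matrix (Fin 2) (Fin 2) ℂ →ₗ[ℂ] ℂ)
        (prodCfg (Ucur (bgOfCfg F K U₀)) (((F.L : ℝ)⁻¹) ^ (K - n)) (curL (flat115 (Tc (A' + (t : ℂ) • δ'))))))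
      (pair27 (LinearMap.toContinuousLinearMap (Matrix.traceLinearMap (Fin 2) ℂ ℂ)) (Jcur (bgOfCfg F K U₀) : NegSize (F.L : ℝ) (((F.L : ℝ)⁻¹) ^ (K - n)) (fun _ : Bond 3 (periodsT3 F K) => K - n) 3 (Matrix (Fin 2) (Fin 2) ℂ)) (flat115 δ')
        + pair27 (LinearMap.toContinuousLinearMap (Matrix.traceLinearMap (Fin 2) ℂ ℂ))
            (currentCLM frobEquiv (fun _ : Bond 3 (periodsT3 F K) × Fin 3 => K - n) (nabla115 (((F.L : ℝ)⁻¹) ^ (K - n)) (bgOfCfg F K U₀)) (Δx U₀) A')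
            (flat115 δ')
        + pair27 (LinearMap.toContinuousLinearMap (Matrix.traceLinearMap (Fin 2) ℂ ℂ)) (W A') (flat115 δ')) 0)
    -- ROW (51)∕(47) conjugacy of the (115)-level chart `Tc` with the route chart near `t = 0` (✓`Prop7ChartConjPInv`)
    (hchart : ∀ δ' : Space115 (F.L : ℝ) (((F.L : ℝ)⁻¹) ^ (K - n)) (fun _ : Bond 3 (periodsT3 F K) => K - n) (fun _ : Bond 3 (periodsT3 F K) × Fin 3 => K - n)
        (nabla115 (((F.L : ℝ)⁻¹) ^ (K - n)) (bgOfCfg F K U₀)),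
      (∀ b' : PBond (F.P K) 0, star (JetSup.equiv _ _ _ δ' (bondEquiv F K b')) = JetSup.equiv _ _ _ δ' (bondEquiv F K b')) →
      (∀ b' : PBond (F.P K) 0, Matrix.trace (JetSup.equiv _ _ _ δ' (bondEquiv F K b')) = 0) →
      QTwS F n K h U₀ (fun b' : PBond (F.P K) 0 => JetSup.equiv _ _ _ δ' (bondEquiv F K b')) = 0 →
      ∀ᶠ t : ℝ in nhds 0,
        ((((eta F n K : ℝ) : ℂ)) * Complex.I) • (fun b' : PBond (F.P K) 0 => JetSup.equiv _ _ _ (Tc (A' + (t : ℂ) • δ')) (bondEquiv F K b'))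
          = ((((((eta F n K : ℝ) : ℂ)) * Complex.I) • (fun b' : PBond (F.P K) 0 => JetSup.equiv _ _ _ A' (bondEquiv F K b'))
                + (t : ℂ) • (((((eta F n K : ℝ) : ℂ)) * Complex.I) • fun b' : PBond (F.P K) 0 => JetSup.equiv _ _ _ δ' (bondEquiv F K b')))
            - H (Dfix (CmapTwS F n K h U₀) H (40 * (2 * (3 * (2 * e + 2700 * (F.L : ℝ) * ε₀))) / (e * eta F n K) ^ 2)
                (((((eta F n K : ℝ) : ℂ)) * Complex.I) • (fun b' : PBond (F.P K) 0 => JetSup.equiv _ _ _ A' (bondEquiv F K b'))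
                + (t : ℂ) • (((((eta F n K : ℝ) : ℂ)) * Complex.I) • fun b' : PBond (F.P K) 0 => JetSup.equiv _ _ _ δ' (bondEquiv F K b')))))) :
    ∃ μ : WL2 ℂ (fun _ : PBond (F.P n) 0 => cB) W₂,
      Δx U₀ (toL2 F K c₀ (fun b' : PBond (F.P K) 0 => JetSup.equiv _ _ _ A' (bondEquiv F K b')))
        + (funEquiv frobEquiv (fun _ : Bond 3 (periodsT3 F K) => c₀)).symm
            (NegSup.equiv _ _ (Jcur (L := (F.L : ℝ)) (η := ((F.L : ℝ)⁻¹) ^ (K - n)) (lev₀ := fun _ : Bond 3 (periodsT3 F K) => K - n) (bgOfCfg F K U₀))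
              + NegSup.equiv _ _ (W A'))
      = LinearMap.adjoint (Qk F n K h c₀ cB U₀) μ := by
  have hηpos : (0 : ℝ) < eta F n K := eta_pos F n K
  -- letters: the route reading `ιA′`, the chart coordinate `A″ := κ_f • ιA′`, the chart `χ`, the exponent `X := −i·χ(A″)`
  set ιA : PBond (F.P K) 0 → Matrix (Fin 2) (Fin 2) ℂ := fun b' : PBond (F.P K) 0 => JetSup.equiv _ _ _ A' (bondEquiv F K b') with hιA
  set Ac : PBond (F.P K) 0 → Matrix (Fin 2) (Fin 2) ℂ := ((((eta F n K : ℝ) : ℂ)) * Complex.I) • ιA with hAc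
  -- `A″` is skew-Hermitian-traceless (reality of `ιA′`)
  have hsI : star ((((eta F n K : ℝ) : ℂ)) * Complex.I) = -((((eta F n K : ℝ) : ℂ)) * Complex.I) := by simp
  have hAcR : ∀ b', star (Ac b') = -Ac b' ∧ (Ac b').trace = 0 := fun b' => by
    simp only [hAc, Pi.smul_apply]
    exact ⟨by rw [star_smul, Matrix.star_eq_conjTranspose, (hA'R b').1.eq, hsI, neg_smul], by rw [Matrix.trace_smul, (hA'R b').2, smul_zero]⟩
  have hAcε : ‖Ac‖ < ε := by linarith [norm_nonneg Ac]
  set X : PBond (F.P K) 0 → Matrix (Fin 2) (Fin 2) ℂ := fun b' => (-Complex.I) • (Ac - H (Dfix (CmapTwS F n K h U₀) H (40 * (2 * (3 * (2 * e + 2700 * (F.L : ℝ) * ε₀))) / (e * eta F n K) ^ 2) Ac)) b' with hXdef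
  have hAX : Ac - H (Dfix (CmapTwS F n K h U₀) H (40 * (2 * (3 * (2 * e + 2700 * (F.L : ℝ) * ε₀))) / (e * eta F n K) ^ 2) Ac) = fun b' => Complex.I • X b' := by
    funext b'
    simp only [hXdef, smul_smul, mul_neg, Complex.I_mul_I, neg_neg, one_smul]
  have hX : ∀ b', (X b').IsHermitian ∧ (X b').trace = 0 :=
    isHermitian_trace_zero_of_chartS F h hε₀ he hWe hWε U₀ hreg hb hHop hHR hq hRε hAcε hAcR hAX
  -- (127) from (93) + the split (★px21's door ✓p650826)
  have h127 := hCrit127_of_hCrit93_of_split127 F h hε₀ he hWe hWε U₀ hreg hb hHop hHR hq hRε hA'ε hAcR hX hAX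
    (fun δ => QTwS F n K h U₀ δ = 0) (fun δ => IsLandauPrintS F n K h c₀ cB U₀ δ)
    (fun δ hδ hK hS => hCrit93 δ hδ hK hS) hSplit127
  -- the `QTwS` sector rows at `U₀ ∈ 𝔘_k(ε₀)`
  have hQ := QTwS_star_comm_of_regPr F h hε₀ he hWe hWε U₀ hreg
  have hQtr := QTwS_traceless_of_regPr F h hε₀ he hWe hWε U₀ hreg
  have hQsc := QTwS_scalar_of_regPr F h hε₀ hWε U₀ hreg
  -- the residual is traceless: slot row + `Ĵ` real ([51]) + `Ŵ(A′)` real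
  have hXtr : ∀ b', ((toL2 F K c₀).symm (Δx U₀ (toL2 F K c₀ ιA)
        + (funEquiv frobEquiv (fun _ : Bond 3 (periodsT3 F K) => c₀)).symm
            (NegSup.equiv _ _ (Jcur (L := (F.L : ℝ)) (η := ((F.L : ℝ)⁻¹) ^ (K - n)) (lev₀ := fun _ : Bond 3 (periodsT3 F K) => K - n) (bgOfCfg F K U₀))
              + NegSup.equiv _ _ (W A'))) b').trace = 0 := by
    intro b'
    rw [map_add, Pi.add_apply, Matrix.trace_add, hOptr ιA (fun b'' => (hA'R b'').2) b', zero_add, toL2_symm_apply, funEquiv_symm_apply,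
      LinearEquiv.apply_symm_apply, Pi.add_apply, Matrix.trace_add, (isHermitian_trace_zero_Jcur_bgOfCfg (n := n) U₀ (bondEquiv F K b')).2, (hWR (bondEquiv F K b')).2, add_zero]
  -- (128) in range form: test against every Hermitian-traceless `aH ∈ ker QTwS` (✓`exists_eq_adjoint_Qk_of_hermitian_traceless`), reading `aH` as `ιδ′`
  refine exists_eq_adjoint_Qk_of_hermitian_traceless U₀ hQ hQtr hQsc hXtr fun aH haR hatr haQ => ?_
  set δ' : Space115 (F.L : ℝ) (((F.L : ℝ)⁻¹) ^ (K - n)) (fun _ : Bond 3 (periodsT3 F K) => K - n) (fun _ : Bond 3 (periodsT3 F K) × Fin 3 => K - n)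
      (nabla115 (((F.L : ℝ)⁻¹) ^ (K - n)) (bgOfCfg F K U₀)) := fun p => aH ((bondEquiv F K).symm p) with hδ'
  have hιb : ∀ b' : PBond (F.P K) 0, JetSup.equiv _ _ _ δ' (bondEquiv F K b') = aH b' := fun b' => by
    show aH ((bondEquiv F K).symm (bondEquiv F K b')) = aH b'
    rw [Equiv.symm_apply_apply]
  have hι : (fun b' : PBond (F.P K) 0 => JetSup.equiv _ _ _ δ' (bondEquiv F K b')) = aH := funext hιb
  have haRb : ∀ b' : PBond (F.P K) 0, star (aH b') = aH b' := fun b' => by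
    have h1 := congrFun haR b'
    rwa [Pi.star_apply] at h1
  have hδR : ∀ b' : PBond (F.P K) 0, star (JetSup.equiv _ _ _ δ' (bondEquiv F K b')) = JetSup.equiv _ _ _ δ' (bondEquiv F K b') := fun b' => by
    rw [hιb b']; exact haRb b'
  have hδtr : ∀ b' : PBond (F.P K) 0, Matrix.trace (JetSup.equiv _ _ _ δ' (bondEquiv F K b')) = 0 := fun b' => by rw [hιb b']; exact hatr b'
  have hδQ : QTwS F n K h U₀ (fun b' : PBond (F.P K) 0 => JetSup.equiv _ _ _ δ' (bondEquiv F K b')) = 0 := by rw [hι]; exact haQ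
  -- (127) at the route direction `δ := κ_f • ιδ′`
  have hsR : ∀ b', star (((((( eta F n K : ℝ) : ℂ)) * Complex.I) • fun b' : PBond (F.P K) 0 => JetSup.equiv _ _ _ δ' (bondEquiv F K b')) b')
      = -((((( eta F n K : ℝ) : ℂ)) * Complex.I) • fun b' : PBond (F.P K) 0 => JetSup.equiv _ _ _ δ' (bondEquiv F K b')) b' ∧
      Matrix.trace (((((( eta F n K : ℝ) : ℂ)) * Complex.I) • fun b' : PBond (F.P K) 0 => JetSup.equiv _ _ _ δ' (bondEquiv F K b')) b') = 0 := fun b' => by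
    simp only [Pi.smul_apply]
    exact ⟨by rw [star_smul, hδR b', hsI, neg_smul], by rw [Matrix.trace_smul, hδtr b', smul_zero]⟩
  have hsQ : QTwS F n K h U₀ (((((eta F n K : ℝ) : ℂ)) * Complex.I) • fun b' : PBond (F.P K) 0 => JetSup.equiv _ _ _ δ' (bondEquiv F K b')) = 0 := by
    rw [map_smul, hδQ, smul_zero]
  have hcr := h127 _ hsR hsQ
  -- reality of the chart value along the ray near `t = 0` ((51) at `A″ + tδ`, which stays in the `ε`-ball)
  have hXR : ∀ᶠ t : ℝ in nhds 0, ∀ b' : PBond (F.P K) 0,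
      (((-Complex.I) • ((Ac + (t : ℂ) • (((((eta F n K : ℝ) : ℂ)) * Complex.I) • fun b' : PBond (F.P K) 0 => JetSup.equiv _ _ _ δ' (bondEquiv F K b')))
          - H (Dfix (CmapTwS F n K h U₀) H (40 * (2 * (3 * (2 * e + 2700 * (F.L : ℝ) * ε₀))) / (e * eta F n K) ^ 2) (Ac + (t : ℂ) • (((((eta F n K : ℝ) : ℂ)) * Complex.I) • fun b' : PBond (F.P K) 0 => JetSup.equiv _ _ _ δ' (bondEquiv F K b')))))) b').IsHermitian ∧
      Matrix.trace (((-Complex.I) • ((Ac + (t : ℂ) • (((((eta F n K : ℝ) : ℂ)) * Complex.I) • fun b' : PBond (F.P K) 0 => JetSup.equiv _ _ _ δ' (bondEquiv F K b')))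
          - H (Dfix (CmapTwS F n K h U₀) H (40 * (2 * (3 * (2 * e + 2700 * (F.L : ℝ) * ε₀))) / (e * eta F n K) ^ 2) (Ac + (t : ℂ) • (((((eta F n K : ℝ) : ℂ)) * Complex.I) • fun b' : PBond (F.P K) 0 => JetSup.equiv _ _ _ δ' (bondEquiv F K b')))))) b') = 0 := by
    set δ : PBond (F.P K) 0 → Matrix (Fin 2) (Fin 2) ℂ := ((((eta F n K : ℝ) : ℂ)) * Complex.I) • fun b' : PBond (F.P K) 0 => JetSup.equiv _ _ _ δ' (bondEquiv F K b') with hδdef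
    have hcont : Filter.Tendsto (fun t : ℝ => Ac + (t : ℂ) • δ) (nhds 0) (nhds Ac) := by
      have h1 : Continuous (fun t : ℝ => Ac + (t : ℂ) • δ) := by fun_prop
      simpa using h1.tendsto 0
    have hball : ∀ᶠ t : ℝ in nhds 0, ‖Ac + (t : ℂ) • δ‖ < ε := by
      have hopen : Metric.ball (0 : PBond (F.P K) 0 → Matrix (Fin 2) (Fin 2) ℂ) ε ∈ nhds Ac :=
        Metric.isOpen_ball.mem_nhds (mem_ball_zero_iff.mpr hAcε)
      filter_upwards [hcont hopen] with t ht
      exact mem_ball_zero_iff.mp ht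
    filter_upwards [hball] with t ht
    have hR := skew_add_real_smul hAcR hsR t
    set Xt : PBond (F.P K) 0 → Matrix (Fin 2) (Fin 2) ℂ := fun b' => (-Complex.I) • ((Ac + (t : ℂ) • δ) - H (Dfix (CmapTwS F n K h U₀) H (40 * (2 * (3 * (2 * e + 2700 * (F.L : ℝ) * ε₀))) / (e * eta F n K) ^ 2) (Ac + (t : ℂ) • δ))) b' with hXt
    have hAXt : (Ac + (t : ℂ) • δ) - H (Dfix (CmapTwS F n K h U₀) H (40 * (2 * (3 * (2 * e + 2700 * (F.L : ℝ) * ε₀))) / (e * eta F n K) ^ 2) (Ac + (t : ℂ) • δ)) = fun b' => Complex.I • Xt b' := by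
      funext b'
      simp only [hXt, smul_smul, mul_neg, Complex.I_mul_I, neg_neg, one_smul]
    have hXt' := isHermitian_trace_zero_of_chartS F h hε₀ he hWe hWε U₀ hreg hb hHop hHR hq hRε ht hR hAXt
    intro b'
    exact hXt' b'
  -- ★px21's (84)-pairing theorem at the free field `A′`, direction `δ′`
  have hmain := inner_toL2_residual_eq_zero_of_hCrit127_of_hasDerivAt_actionZ_field (c₀ := c₀) (Δx := Δx) U₀ A' W Tc
    (fun Y => Y - H (Dfix (CmapTwS F n K h U₀) H (40 * (2 * (3 * (2 * e + 2700 * (F.L : ℝ) * ε₀))) / (e * eta F n K) ^ 2) Y)) hδR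
    (hZ δ' hδR hδtr hδQ) (hchart δ' hδR hδtr hδQ) hXR hcr
  rw [hι] at hmain
  exact hmain

end Summit.QuantumFields.YangMills.Theorems.Prop7H128OfCrit93Split127Member

end
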